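import Summits.NavierStokesRegularity.NavierStokesRegularity.Theorems.OddMorawetzOddMorawetzLocalJetDecayKernel
import Literature.Analysis.FluidPDE.TaoAveragedEulerContDiff

/-!
# `stub_jetDecay`: `|x|⁻⁴` decay of the jets of the Euler bilinear term of a divergence-free Schwartz field

Crux `OddMorawetzLocal` (item stmt-NavierStokesRegularity-1376), birth-skeleton stub `stub_jetDecay`: for a
divergence-free Schwartz field `v` on `ℝ³`, `b = B(v,v) = eulerBilinear v v = -½ P[2(v·∇)v]` is smooth (the tree's
`contDiff_eulerBilinear_holds`) and `(1 + |x|)⁴ ‖Dⁿ b(x)‖ ≤ C` for `n ≤ 4` (T. Tao, J. Amer. Math. Soc. 29 (2016),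
§1.1, display after (1.8): `P div(v ⊗ v) = O(|x|^{-d-1})`, here `d = 3`).

## Proof (`JetDecay.eulerBilinear_jet_decay`, every order `n`)

By the tree's `exists_leraySymbolC_fourier_repr`, `P̂ ŵ = ŵ + s` with `s(ξ) = ∑ₖ (𝓕gₖ(ξ)/(4π²|ξ|²)) eₖ`,
`gₖ = ∑ₘ ∂ₖ∂_{m₁}∂_{m₂} S_{k,m}` Schwartz, so by Fourier inversion `b = -½ (w + Re 𝓕s(-·))` with `w = 2(v·∇)v`
Schwartz.  The moments of `s` are integrable (file II), so `𝓕 s` is smooth with `Dⁿ 𝓕s = 𝓕[(-2πi ξ·)^{⊗n} s]`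
(Mathlib's `Real.iteratedFDeriv_fourier`), whose basis coefficients are finite sums of `Φ • eₖ`,
`Φ = ρ • T` with `T` Schwartz and `ρ(ξ) = (∏ of n+3 coordinates)/|ξ|²` positively homogeneous of degree `n + 1 ≥ 1`
(file II, `fourierPowSMulRight_symbol_apply`); each has `(1 + |x|)⁴ |𝓕Φ(x)| ≤ C` by the kernel estimate of file
III (`fourier_decay_piece`).  The Schwartz part `w` is handled by its seminorms.
-/

noncomputable section

open MeasureTheory Filter Topology Set FourierTransform Metric Complex VectorFourier
open Literature.Analysis Literature.Analysis.FluidPDE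
open scoped Real RealInnerProductSpace ContDiff SchwartzMap LineDeriv

-- the problem namespace `Summit.NavierStokesRegularity.NavierStokesRegularity` repeats the summit name by design (D-0017)
set_option linter.dupNamespace false

namespace Summit.NavierStokesRegularity.NavierStokesRegularity.Theorems

namespace JetDecay

/-- Frequency / physical space `ℝ³`. -/
local notation "E3" => EuclideanSpace ℝ (Fin 3)

/-! ### The pieces and the assembly -/

/-- **Decay of one basis coefficient.** For unit-type vectors `aᵢ, b, c, d` and a Schwartz function `T`, the scalar
symbol `Φ(ξ) = (∏ᵢ⟪ξ,aᵢ⟫)⟪ξ,b⟫⟪ξ,c⟫⟪ξ,d⟫ / |ξ|² · T(ξ)` (homogeneous of degree `n + 1 ≥ 1` times Schwartz) is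
integrable with `(1 + |x|)⁴ |𝓕 Φ(x)| ≤ C`. -/
theorem fourier_decay_piece (n : ℕ) (a : Fin n → E3) (b c d : E3) (T : 𝓢(E3, ℂ)) :
    Integrable (fun ξ : E3 => (((∏ i, ⟪ξ, a i⟫) * (⟪ξ, b⟫ * ⟪ξ, c⟫ * ⟪ξ, d⟫)) / ‖ξ‖ ^ 2) • T ξ) ∧
      ∃ C, ∀ x : E3, (1 + ‖x‖) ^ 4 *
        ‖𝓕 (fun ξ : E3 => (((∏ i, ⟪ξ, a i⟫) * (⟪ξ, b⟫ * ⟪ξ, c⟫ * ⟪ξ, d⟫)) / ‖ξ‖ ^ 2) • T ξ) x‖ ≤ C := by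
  have hp : ContDiff ℝ ∞ (fun ξ : E3 => (∏ i, ⟪ξ, a i⟫) * (⟪ξ, b⟫ * ⟪ξ, c⟫ * ⟪ξ, d⟫)) := by
    refine (contDiff_prod fun i _ => contDiff_id.inner ℝ contDiff_const).mul ?_
    exact ((contDiff_id.inner ℝ contDiff_const).mul (contDiff_id.inner ℝ contDiff_const)).mul
      (contDiff_id.inner ℝ contDiff_const)
  have hhom : ∀ t : ℝ, 0 < t → ∀ ξ : E3,
      (∏ i, ⟪t • ξ, a i⟫) * (⟪t • ξ, b⟫ * ⟪t • ξ, c⟫ * ⟪t • ξ, d⟫) =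
        t ^ (n + 3) * ((∏ i, ⟪ξ, a i⟫) * (⟪ξ, b⟫ * ⟪ξ, c⟫ * ⟪ξ, d⟫)) := by
    intro t ht ξ
    simp only [real_inner_smul_left, Finset.prod_mul_distrib, Finset.prod_const, Finset.card_univ,
      Fintype.card_fin]
    ring
  obtain ⟨hρ, hρhom⟩ := homogeneous_div_normSq hp (by omega : 2 ≤ n + 3) hhom
  have hk : 1 ≤ n + 3 - 2 := by omega
  exact fourier_decay_of_homogeneous hk hρ hρhom T

/-- **Jet decay of the Euler bilinear term, order by order**: for a divergence-free Schwartz field `v` on `ℝ³` and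
every `n`, `(1 + |x|)⁴ ‖Dⁿ B(v,v)(x)‖` is bounded (Tao 2016, §1.1: `P div(v ⊗ v) = O(|x|^{-d-1})`, `d = 3`).
`B(v,v) = -½ (w + Re 𝓕s(-·))` with `w = 2(v·∇)v` Schwartz and the basis coefficients of `Dⁿ 𝓕 s = 𝓕[(-2πiξ·)^{⊗n} s]`
handled by `fourier_decay_piece`. -/
theorem eulerBilinear_jet_decay {v : E3 → E3} (hv : IsSchwartzField v)
    (hd : VectorCalculus.IsDivFree v) (n : ℕ) :
    ∃ K, ∀ x : E3, (1 + ‖x‖) ^ 4 * ‖iteratedFDeriv ℝ n (eulerBilinear v v) x‖ ≤ K := by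
  obtain ⟨V, rfl⟩ := hv
  obtain ⟨W₀, hW₀⟩ :=
    ContDiffEuler.isSchwartzField_convect_add (ι := Fin 3) (u := ⇑V) (v := ⇑V) ⟨V, rfl⟩ ⟨V, rfl⟩
  obtain ⟨W, g, hW, hg, hP⟩ := exists_leraySymbolC_fourier_repr V V hd hd
  choose S hS using hg
  set w : E3 → E3 := fun x => convect (⇑V) (⇑V) x + convect (⇑V) (⇑V) x with hw_def
  set s : E3 → EuclideanSpace ℂ (Fin 3) := fun ξ => ∑ k, (𝓕 (⇑(g k)) ξ /
    (((2 * π) ^ 2 * ‖ξ‖ ^ 2 : ℝ) : ℂ)) • EuclideanSpace.single k (1 : ℂ) with hs_def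
  set Re : EuclideanSpace ℂ (Fin 3) →L[ℝ] E3 := FunctionSpaces.EuclideanSpace.realPart with hRe
  -- (1) moments of `s`, smoothness of `𝓕 s`
  have hsm : AEStronglyMeasurable s volume := (integrable_pow_mul_norm_symbol g S hS 0).1
  have hmom : ∀ j : ℕ, Integrable (fun ξ => ‖ξ‖ ^ j * ‖s ξ‖) := fun j =>
    (integrable_pow_mul_norm_symbol g S hS j).2
  have hsi : Integrable s := by
    have h := hmom 0
    simp only [pow_zero, one_mul] at h
    exact (integrable_norm_iff hsm).1 h
  have hFs : ContDiff ℝ ∞ (𝓕 s) := Real.contDiff_fourier (N := (⊤ : ℕ∞)) fun j _ => hmom j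
  -- (2) the representation `B(v,v) = -½ (w + Re 𝓕 s (-·))`
  have hcw : FunctionSpaces.EuclideanSpace.complexify ∘ w = ⇑W := by
    rw [hW]
    rfl
  have hFw : fourierVec w = 𝓕 (⇑W) := by
    unfold fourierVec
    rw [hcw]
  have hFWi : Integrable (𝓕 (⇑W)) := by
    rw [← SchwartzMap.fourier_coe]
    exact (𝓕 W).integrable
  have hGeq : (fun ξ => leraySymbolC ξ (fourierVec w ξ)) = 𝓕 (⇑W) + s := by
    funext ξ
    rw [hFw, hP ξ]
    rfl
  have hKer : 𝓕⁻ (fun ξ => leraySymbolC ξ (fourierVec w ξ)) = fun x => W x + 𝓕 s (-x) := by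
    rw [hGeq]
    have hL : Continuous fun p : E3 × E3 => (-innerₗ E3) p.1 p.2 := continuous_inner.neg
    have hadd := VectorFourier.fourierIntegral_add Real.continuous_fourierChar hL hFWi hsi
    change VectorFourier.fourierIntegral 𝐞 volume (-innerₗ E3) (𝓕 (⇑W) + s) = _
    rw [hadd]
    have h1 : VectorFourier.fourierIntegral 𝐞 volume (-innerₗ E3) (𝓕 (⇑W)) = ⇑W :=
      W.continuous.fourierInv_fourier_eq W.integrable hFWi
    rw [h1]
    funext x
    rw [Pi.add_apply]
    congr 1
    exact Real.fourierInv_eq_fourier_neg s x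
  have hrep : eulerBilinear (⇑V) (⇑V) = (-(2 : ℝ)⁻¹) • fun x => w x + Re (𝓕 s (-x)) := by
    have hB : eulerBilinear (⇑V) (⇑V) =
        fun x => -(2 : ℝ)⁻¹ • realPart (𝓕⁻ (fun ξ => leraySymbolC ξ (fourierVec w ξ)) x) := by
      funext x
      simp only [eulerBilinear, lerayProjFun, Pi.smul_apply]
      rfl
    rw [hB, hKer]
    funext x
    simp only [Pi.smul_apply]
    congr 1
    have hWx : W x = FunctionSpaces.EuclideanSpace.complexify (w x) := by
      rw [← hcw]
      rfl
    rw [hWx]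
    change Re (FunctionSpaces.EuclideanSpace.complexify (w x) + 𝓕 s (-x)) = _
    have hRc : Re (FunctionSpaces.EuclideanSpace.complexify (w x)) = w x :=
      FunctionSpaces.EuclideanSpace.realPart_complexify (w x)
    rw [map_add, hRc]
  -- (3) decay of the basis coefficients of `Dⁿ 𝓕 s`
  have hcoef : ∀ α : Fin n → Fin 3, ∃ C, ∀ z : E3, (1 + ‖z‖) ^ 4 *
      ‖iteratedFDeriv ℝ n (𝓕 s) z (fun i => EuclideanSpace.single (α i) (1 : ℝ))‖ ≤ C := by
    intro α
    have hpiece := fun σ : Fin 3 × (Fin 3 × Fin 3) =>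
      fourier_decay_piece n (fun i => EuclideanSpace.single (α i) (1 : ℝ))
        (EuclideanSpace.single σ.1 (1 : ℝ)) (EuclideanSpace.single σ.2.1 (1 : ℝ))
        (EuclideanSpace.single σ.2.2 (1 : ℝ))
        (((-(2 * π * I)) ^ n * ((2 * π * I) ^ 3 / (2 * π) ^ 2)) • 𝓕 (S σ.1 σ.2))
    choose hint hC using hpiece
    choose Cσ hCσ using hC
    refine ⟨∑ σ, Cσ σ, fun z => ?_⟩
    have hD : iteratedFDeriv ℝ n (𝓕 s) = 𝓕 (fun ξ => fourierPowSMulRight (innerSL ℝ) s ξ n) :=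
      Real.iteratedFDeriv_fourier (N := (⊤ : ℕ∞)) (fun j _ => hmom j) hsm (by exact_mod_cast le_top)
    have happly : iteratedFDeriv ℝ n (𝓕 s) z (fun i => EuclideanSpace.single (α i) (1 : ℝ)) =
        𝓕 (fun ξ => fourierPowSMulRight (innerSL ℝ) s ξ n
          (fun i => EuclideanSpace.single (α i) (1 : ℝ))) z := by
      rw [hD, Real.fourier_continuousMultilinearMap_apply
        (integrable_fourierPowSMulRight _ (hmom n) hsm)]
    have halg : (fun ξ => fourierPowSMulRight (innerSL ℝ) s ξ n
        (fun i => EuclideanSpace.single (α i) (1 : ℝ))) =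
        ∑ σ : Fin 3 × (Fin 3 × Fin 3), fun ξ : E3 =>
          ((((∏ i, ⟪ξ, EuclideanSpace.single (α i) (1 : ℝ)⟫) *
            (⟪ξ, EuclideanSpace.single σ.1 (1 : ℝ)⟫ * ⟪ξ, EuclideanSpace.single σ.2.1 (1 : ℝ)⟫ *
              ⟪ξ, EuclideanSpace.single σ.2.2 (1 : ℝ)⟫)) / ‖ξ‖ ^ 2) •
            (((-(2 * π * I)) ^ n * ((2 * π * I) ^ 3 / (2 * π) ^ 2)) • 𝓕 (S σ.1 σ.2)) ξ) •
              EuclideanSpace.single σ.1 (1 : ℂ) := by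
      funext ξ
      rw [Finset.sum_apply]
      exact fourierPowSMulRight_symbol_apply g S hS n α ξ
    rw [happly, halg, fourier_finset_sum _ (fun σ _ => (hint σ).smul_const _), Finset.sum_apply]
    refine (mul_le_mul_of_nonneg_left (norm_sum_le _ _) (by positivity)).trans ?_
    rw [Finset.mul_sum]
    refine Finset.sum_le_sum fun σ _ => ?_
    rw [fourier_smul_const, norm_smul, PiLp.norm_single, norm_one, mul_one]
    exact hCσ σ z
  choose Cα hCα using hcoef
  -- (4) assembly
  have hwS : ContDiff ℝ ∞ w := by
    rw [← hW₀]
    exact W₀.smooth _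
  have hG : ContDiff ℝ ∞ (fun x : E3 => Re (𝓕 s (-x))) := Re.contDiff.comp (hFs.comp contDiff_neg)
  have hF : ContDiff ℝ ∞ (fun x : E3 => w x + Re (𝓕 s (-x))) := hwS.add hG
  refine ⟨2⁻¹ * (2 ^ 4 * (Finset.Iic (4, n)).sup (fun m => SchwartzMap.seminorm ℝ m.1 m.2) W₀ +
    ‖Re‖ * ∑ α : Fin n → Fin 3, Cα α), fun x => ?_⟩
  have h1 : (1 + ‖x‖) ^ 4 * ‖iteratedFDeriv ℝ n w x‖ ≤
      2 ^ 4 * (Finset.Iic (4, n)).sup (fun m => SchwartzMap.seminorm ℝ m.1 m.2) W₀ := by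
    rw [← hW₀]
    exact SchwartzMap.one_add_le_sup_seminorm_apply (𝕜 := ℝ) (m := (4, n)) le_rfl le_rfl W₀ x
  have h2 : (1 + ‖x‖) ^ 4 * ‖iteratedFDeriv ℝ n (fun x : E3 => Re (𝓕 s (-x))) x‖ ≤
      ‖Re‖ * ∑ α, Cα α := by
    have hcomp : (fun x : E3 => Re (𝓕 s (-x))) =
        (⇑Re ∘ 𝓕 s) ∘ ⇑(LinearIsometryEquiv.neg ℝ : E3 ≃ₗᵢ[ℝ] E3) := by
      funext y
      simp
    rw [hcomp, LinearIsometryEquiv.norm_iteratedFDeriv_comp_right]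
    have hneg : (LinearIsometryEquiv.neg ℝ : E3 ≃ₗᵢ[ℝ] E3) x = -x := rfl
    rw [hneg]
    have h3 : ‖iteratedFDeriv ℝ n (⇑Re ∘ 𝓕 s) (-x)‖ ≤ ‖Re‖ * ‖iteratedFDeriv ℝ n (𝓕 s) (-x)‖ :=
      Re.norm_iteratedFDeriv_comp_left hFs.contDiffAt (by exact_mod_cast le_top)
    have h4 : ‖iteratedFDeriv ℝ n (𝓕 s) (-x)‖ ≤ ∑ α : Fin n → Fin 3,
        ‖iteratedFDeriv ℝ n (𝓕 s) (-x) (fun i => EuclideanSpace.single (α i) (1 : ℝ))‖ :=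
      ContDiffEuler.norm_continuousMultilinearMap_le_sum_single _
    have h5 : ∀ α : Fin n → Fin 3, (1 + ‖x‖) ^ 4 *
        ‖iteratedFDeriv ℝ n (𝓕 s) (-x) (fun i => EuclideanSpace.single (α i) (1 : ℝ))‖ ≤ Cα α :=
      fun α => by
        have h := hCα α (-x)
        rwa [norm_neg] at h
    calc (1 + ‖x‖) ^ 4 * ‖iteratedFDeriv ℝ n (⇑Re ∘ 𝓕 s) (-x)‖
        ≤ (1 + ‖x‖) ^ 4 * (‖Re‖ * ∑ α : Fin n → Fin 3,
            ‖iteratedFDeriv ℝ n (𝓕 s) (-x) (fun i => EuclideanSpace.single (α i) (1 : ℝ))‖) := by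
          gcongr
          exact h3.trans (by gcongr)
      _ = ‖Re‖ * ∑ α : Fin n → Fin 3, (1 + ‖x‖) ^ 4 *
            ‖iteratedFDeriv ℝ n (𝓕 s) (-x) (fun i => EuclideanSpace.single (α i) (1 : ℝ))‖ := by
          rw [mul_left_comm, Finset.mul_sum]
      _ ≤ ‖Re‖ * ∑ α : Fin n → Fin 3, Cα α := by
          gcongr with α
          exact h5 α
  rw [hrep, iteratedFDeriv_const_smul_apply (hF.contDiffAt.of_le (by exact_mod_cast le_top)),
    norm_smul, norm_neg, norm_inv, Real.norm_two]
  have hadd : iteratedFDeriv ℝ n (fun x : E3 => w x + Re (𝓕 s (-x))) x =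
      iteratedFDeriv ℝ n w x + iteratedFDeriv ℝ n (fun x : E3 => Re (𝓕 s (-x))) x :=
    iteratedFDeriv_add_apply (f := w) (hwS.contDiffAt.of_le (by exact_mod_cast le_top))
      (hG.contDiffAt.of_le (by exact_mod_cast le_top))
  rw [hadd]
  calc (1 + ‖x‖) ^ 4 * (2⁻¹ * ‖iteratedFDeriv ℝ n w x +
        iteratedFDeriv ℝ n (fun x : E3 => Re (𝓕 s (-x))) x‖)
      ≤ (1 + ‖x‖) ^ 4 * (2⁻¹ * (‖iteratedFDeriv ℝ n w x‖ +
          ‖iteratedFDeriv ℝ n (fun x : E3 => Re (𝓕 s (-x))) x‖)) := by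
        gcongr
        exact norm_add_le _ _
    _ = 2⁻¹ * ((1 + ‖x‖) ^ 4 * ‖iteratedFDeriv ℝ n w x‖ +
          (1 + ‖x‖) ^ 4 * ‖iteratedFDeriv ℝ n (fun x : E3 => Re (𝓕 s (-x))) x‖) := by ring
    _ ≤ 2⁻¹ * (2 ^ 4 * (Finset.Iic (4, n)).sup (fun m => SchwartzMap.seminorm ℝ m.1 m.2) W₀ +
          ‖Re‖ * ∑ α : Fin n → Fin 3, Cα α) := by
        gcongr

end JetDecay

/-- **stub 2 — `stub_jetDecay`** (crux `OddMorawetzLocal`, birth skeleton; harmonic analysis of the Leray-projected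
nonlinearity). For a divergence-free Schwartz field `v` on `ℝ³`, `b = B(v,v) = eulerBilinear v v` is smooth (the
tree's `contDiff_eulerBilinear_holds`) and its jets of order `≤ 4` decay like `|x|⁻⁴`:
`(1 + |x|)⁴ ‖Dⁿ b(x)‖ ≤ C` for `n ≤ 4` (Tao 2016, §1.1: `P div(v ⊗ v) = O(|x|^{-d-1})`; here via
`JetDecay.eulerBilinear_jet_decay`, a frequency-side kernel estimate for the homogeneous Leray symbol). -/
theorem stub_jetDecay :
    ∀ v : EuclideanSpace ℝ (Fin 3) → EuclideanSpace ℝ (Fin 3),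
      Literature.Analysis.FluidPDE.IsSchwartzField v → Literature.Analysis.FluidPDE.VectorCalculus.IsDivFree v →
      ContDiff ℝ (⊤ : ℕ∞) (Literature.Analysis.FluidPDE.eulerBilinear v v) ∧
        ∃ C : ℝ, ∀ n : ℕ, n ≤ 4 → ∀ x : EuclideanSpace ℝ (Fin 3),
          (1 + ‖x‖) ^ 4 * ‖iteratedFDeriv ℝ n (Literature.Analysis.FluidPDE.eulerBilinear v v) x‖ ≤ C := by
  intro v hv hd
  refine ⟨(contDiff_eulerBilinear_holds (ι := Fin 3) hv hv).1, ?_⟩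
  choose K hK using fun n => JetDecay.eulerBilinear_jet_decay hv hd n
  refine ⟨∑ n ∈ Finset.range 5, |K n|, fun n hn x => ?_⟩
  calc (1 + ‖x‖) ^ 4 * ‖iteratedFDeriv ℝ n (eulerBilinear v v) x‖ ≤ K n := hK n x
    _ ≤ |K n| := le_abs_self _
    _ ≤ ∑ m ∈ Finset.range 5, |K m| :=
        Finset.single_le_sum (f := fun m => |K m|) (fun m _ => abs_nonneg _)
          (Finset.mem_range.2 (by omega))

end Summit.NavierStokesRegularity.NavierStokesRegularity.Theorems
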